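import Summits.QuantumFields.BalabanUV.T4Continuum.Spine.NE1p.B7AveragingIterateCommutatorSpan

/-!
# T⁴ programme, spine estimate NE1′ (node O3b/H2) — THE ITERATE (43) AT SECOND ORDER, SIZE: a NORM BOUND on the quadratic
# term of every level of `log Ū^{j}(e^{tA})` by the largest pairwise commutator of the field's values

Cell `pub-balaban-gaps` (YM blitz Y1, track G2), seat `ne1` gen 10 (prover-pub-balaban-gaps-ne1-g10-0); record `HOME/ne/NE1.md`
v10 §6 (xviii).  ADDITIVE — imports this seat's `B7AveragingIterateCommutatorSpan` (gen 10) and through it files 7–10 and the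
lineages' `B7Prop1Explicit` (`norm_avg_le`, `length_gammaWord`, `l1_boxVec_le`, `length_seg`, …) ∕ `B7Prop2Explicit` ∕
`B7Prop3Flat` BY NAME; 0 def.

WHAT THIS FILE PROVES ([folklore] bookkeeping — the first QUANTITATIVE statement of this seat's «curvature channel» on the
printed iterate, at the flat background; 0 sorry).  `m` bounds all pairwise commutators, `‖A(b)A(b′) − A(b′)A(b)‖ ≤ m`.
* §1 `norm_comm_*_le`: signed letters `≤ m`, letter∕path sum `≤ |Γ|·m`, two path sums `≤ |Γ||Γ′|·m`, `[X̂_c(B), B(Γ)]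
  ≤ (2d+2)L·|Γ|·m` (the contours `Γ_{c,x} ∪ (−Γ_c)` have at most `2dL + 2L` letters), `[T_c(B), T_{c′}(B)] ≤ (2dL + L)²·m`, and
  every linear iterate: **`norm_comm_linIterate_le` — `‖[A_j(b), A_j(b′)]‖ ≤ ((2d+3)L)^{2j}·m`** (`A_j = (rescale∘T)^{j}(A)`; the
  `L^{2j}` is the honest scaling of a connection in coarse-lattice units, the `d`-dependence is crude).
* §2 along a curve with local data (file 10's shape), bond curvatures `≤ K`, `[A(b), A(b′)] ≤ m`: words
  `≤ |Γ|K + |Γ|²m` (`norm_iteratedDeriv_two_mlog_hol_curve_le`), averaged bonds **`≤ (2d+3)L·K + ((2d+3)L)²·m`**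
  (`norm_iteratedDeriv_two_mlog_bavg_curve_le`), and by induction over (43) with §1:
  **`norm_iteratedDeriv_two_mlog_avgIter_le` — `‖d²/dt²|₀ log Ū^{j}(V(t))(b)‖ ≤ a^{j}K + j·a^{2j}·m`, `a = (2d+3)L`.**
* §3 the ray `e^{tA}` (`K = 0`): **`norm_iteratedDeriv_two_mlog_bavg_expCfg_le` — `‖d²/dt²|₀ log Ū_c(e^{tA})‖ ≤ ((2d+3)L)²·m`
  for every `L`-bond `c`** (level 1, gen 9's door (d) formula made a number) and **`norm_iteratedDeriv_two_mlog_avgIter_expCfg_le`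
  — `‖d²/dt²|₀ log Ū^{j}(e^{tA})(b)‖ ≤ j·((2d+3)L)^{2j}·m` at every level**: the diagonal curvature of Bałaban's iterated
  averaging with its contour system is controlled by the NON-COMMUTATIVITY of the field ALONE (zero in every abelian sector,
  small for nearly-commuting fields) — the quantitative form, at `U₀ = 1`, of NE1.md R46 (a)'s structural reading.
What it does NOT do: the same at a CURVED background `U₀` («∝ non-flatness», Prop. 4's (121)∕(127)∕(136)), sharp constants,
RG densities (α).

HONEST FRAMING.  [folklore] bookkeeping with crude constants; nothing of Bałaban's asserted; NE1′ NOT proved; spine 0∕9; (B)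
0∕13; binders 0∕6; one fixed finite T⁴ — NOT ℝ⁴, NOT infinite volume, NOT a mass gap, NOT Clay.
-/

noncomputable section

open scoped Topology
open NormedSpace Filter

namespace Summit.QuantumFields.BalabanUV.T4Continuum.NE1p.B7AveragingCommutator

open Literature.MathematicalPhysics.QuantumFieldTheory.Balaban1983to89.MatrixLog (mlog)
open Literature.MathematicalPhysics.QuantumFieldTheory.Balaban1983to89.B7Prop1Explicit
open Literature.MathematicalPhysics.QuantumFieldTheory.Balaban1983to89.B7Prop2Explicit (rescale rescale_apply avgIter)
open Literature.MathematicalPhysics.QuantumFieldTheory.Balaban1983to89.B7Prop3Flat (expCfg)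
open Literature.MathematicalPhysics.QuantumFieldTheory.Balaban1983to89.B7Prop3GeneralRotated (expCfg_zero)

variable {𝔸 : Type*} [NormedRing 𝔸] [NormedAlgebra ℂ 𝔸] [CompleteSpace 𝔸]

/-! ## §1 Norms of commutators: letters, path sums, `X̂`, `T`, linear iterates -/

section CommBound

variable {d : ℕ} {B : Site d → Fin d → 𝔸} {M : ℝ}
  (hB : ∀ (x : Site d) (κ : Fin d) (y : Site d) (μ : Fin d), ‖B x κ * B y μ - B y μ * B x κ‖ ≤ M)

omit [CompleteSpace 𝔸] in
/-- The commutator of an equally-weighted real combination with `b` is the combination of the commutators (bilinearity; the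
weights `L^{−d}` of (42)). [folklore] -/
theorem comm_sum_smul_const_eq {ι : Type*} [Fintype ι] (c : ℝ) (a : ι → 𝔸) (b : 𝔸) :
    (∑ i, c • a i) * b - b * (∑ i, c • a i) = ∑ i, c • (a i * b - b * a i) := by
  rw [Finset.sum_mul, Finset.mul_sum, ← Finset.sum_sub_distrib]
  refine Finset.sum_congr rfl fun i _ => ?_
  rw [smul_mul_assoc, mul_smul_comm, ← smul_sub]

omit [NormedAlgebra ℂ 𝔸] [CompleteSpace 𝔸] in
/-- The contour `Γ_{c,x} ∪ (−Γ_c)` of (42) has at most `2dL + 2L` letters. [cite: Balaban1985Averaging, (14) p.19, (42) p.23] -/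
theorem length_gammaWord_loop_le (L : ℕ) (κ : Fin d) (r : Fin d → Fin L) :
    ((gammaWord L κ (boxVec L r) ++ seg κ (-(L : ℤ))).length : ℝ) ≤ 2 * d * L + 2 * L := by
  have h1 : (l1 (boxVec L r) : ℝ) ≤ d * L := by exact_mod_cast l1_boxVec_le L r
  rw [List.length_append, length_gammaWord, length_seg, Int.natAbs_neg, Int.natAbs_natCast]
  push_cast
  linarith

omit [NormedAlgebra ℂ 𝔸] [CompleteSpace 𝔸] in
/-- The contour `Γ_{c,x}` of (14) has at most `2dL + L` letters. [cite: Balaban1985Averaging, (14) p.19] -/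
theorem length_gammaWord_le (L : ℕ) (κ : Fin d) (r : Fin d → Fin L) :
    ((gammaWord L κ (boxVec L r)).length : ℝ) ≤ 2 * d * L + L := by
  have h1 : (l1 (boxVec L r) : ℝ) ≤ d * L := by exact_mod_cast l1_boxVec_le L r
  rw [length_gammaWord]
  push_cast
  linarith

include hB

omit [NormedAlgebra ℂ 𝔸] [CompleteSpace 𝔸] in
/-- Signed letters: `‖[stepA B b, stepA B b′]‖ ≤ m`. [folklore] -/
theorem norm_comm_stepA_stepA_le (x : Site d) (l : Letter d) (y : Site d) (l' : Letter d) :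
    ‖stepA B x l * stepA B y l' - stepA B y l' * stepA B x l‖ ≤ M := by
  have n1 : ∀ X Y : 𝔸, -X * Y - Y * -X = -(X * Y - Y * X) := fun X Y => by noncomm_ring
  have n2 : ∀ X Y : 𝔸, X * -Y - -Y * X = -(X * Y - Y * X) := fun X Y => by noncomm_ring
  have n3 : ∀ X Y : 𝔸, -X * -Y - -Y * -X = X * Y - Y * X := fun X Y => by noncomm_ring
  obtain ⟨κ, b⟩ := l
  obtain ⟨μ, b'⟩ := l'
  cases b <;> cases b' <;> simp only [stepA_true, stepA_false]
  · rw [n3]; exact hB _ _ _ _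
  · rw [n1, norm_neg]; exact hB _ _ _ _
  · rw [n2, norm_neg]; exact hB _ _ _ _
  · exact hB _ _ _ _

omit [NormedAlgebra ℂ 𝔸] [CompleteSpace 𝔸] in
/-- A letter against a path sum: `‖[stepA B b, B(Γ)]‖ ≤ |Γ|·m`. [folklore] -/
theorem norm_comm_stepA_asum_le (x : Site d) (l : Letter d) :
    ∀ (w : List (Letter d)) (y : Site d), ‖stepA B x l * asum B y w - asum B y w * stepA B x l‖ ≤ w.length * M
  | [], y => by simp
  | l' :: w, y => by
    rw [asum_cons, List.length_cons]
    have e : stepA B x l * (stepA B y l' + asum B (y + l'.vec) w) - (stepA B y l' + asum B (y + l'.vec) w) * stepA B x l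
        = (stepA B x l * stepA B y l' - stepA B y l' * stepA B x l)
          + (stepA B x l * asum B (y + l'.vec) w - asum B (y + l'.vec) w * stepA B x l) := by noncomm_ring
    rw [e]
    calc _ ≤ ‖stepA B x l * stepA B y l' - stepA B y l' * stepA B x l‖
          + ‖stepA B x l * asum B (y + l'.vec) w - asum B (y + l'.vec) w * stepA B x l‖ := norm_add_le _ _
      _ ≤ M + w.length * M := add_le_add (norm_comm_stepA_stepA_le hB x l y l') (norm_comm_stepA_asum_le x l w _)
      _ = ((w.length + 1 : ℕ) : ℝ) * M := by push_cast; ring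

omit [NormedAlgebra ℂ 𝔸] [CompleteSpace 𝔸] in
/-- Two path sums: `‖[B(Γ), B(Γ′)]‖ ≤ |Γ||Γ′|·m`. [folklore] -/
theorem norm_comm_asum_asum_le :
    ∀ (w₁ : List (Letter d)) (x : Site d) (w₂ : List (Letter d)) (y : Site d),
      ‖asum B x w₁ * asum B y w₂ - asum B y w₂ * asum B x w₁‖ ≤ w₁.length * w₂.length * M
  | [], x, w₂, y => by simp
  | l :: w₁, x, w₂, y => by
    rw [asum_cons, List.length_cons]
    have e : (stepA B x l + asum B (x + l.vec) w₁) * asum B y w₂ - asum B y w₂ * (stepA B x l + asum B (x + l.vec) w₁)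
        = (stepA B x l * asum B y w₂ - asum B y w₂ * stepA B x l)
          + (asum B (x + l.vec) w₁ * asum B y w₂ - asum B y w₂ * asum B (x + l.vec) w₁) := by noncomm_ring
    rw [e]
    calc _ ≤ ‖stepA B x l * asum B y w₂ - asum B y w₂ * stepA B x l‖
          + ‖asum B (x + l.vec) w₁ * asum B y w₂ - asum B y w₂ * asum B (x + l.vec) w₁‖ := norm_add_le _ _
      _ ≤ w₂.length * M + w₁.length * w₂.length * M :=
          add_le_add (norm_comm_stepA_asum_le hB x l w₂ y) (norm_comm_asum_asum_le w₁ _ w₂ y)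
      _ = ((w₁.length + 1 : ℕ) : ℝ) * w₂.length * M := by push_cast; ring

omit [CompleteSpace 𝔸] in
/-- The first-order exponent against a path sum: `‖[X̂_c(B), B(Γ)]‖ ≤ (2dL + 2L)·|Γ|·m` (`X̂_c` is an `L^{−d}`-average of path
sums of at most `2dL + 2L` letters; `B7Prop1Explicit.norm_avg_le`). [cite: Balaban1985Averaging, p.25 (displays before (47))] -/
theorem norm_comm_Xhat_asum_le (L : ℕ) (hL : 1 ≤ L) (hM : 0 ≤ M) (q : Site d) (κ : Fin d) (y : Site d)
    (w : List (Letter d)) :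
    ‖Xhat L B q κ * asum B y w - asum B y w * Xhat L B q κ‖ ≤ (2 * d * L + 2 * L) * w.length * M := by
  unfold Xhat
  rw [comm_sum_smul_const_eq]
  refine norm_avg_le L hL _ fun r => ?_
  have hw : (0 : ℝ) ≤ w.length * M := mul_nonneg (Nat.cast_nonneg _) hM
  calc _ ≤ ((gammaWord L κ (boxVec L r) ++ seg κ (-(L : ℤ))).length : ℝ) * w.length * M :=
        norm_comm_asum_asum_le hB _ _ _ _
    _ = ((gammaWord L κ (boxVec L r) ++ seg κ (-(L : ℤ))).length : ℝ) * (w.length * M) := by ring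
    _ ≤ (2 * d * L + 2 * L) * (w.length * M) := mul_le_mul_of_nonneg_right (length_gammaWord_loop_le L κ r) hw
    _ = (2 * d * L + 2 * L) * w.length * M := by ring

omit [CompleteSpace 𝔸] in
/-- Two first-order terms `T_c(B) = L·B̄_c` (14): `‖[T_c(B), T_{c′}(B)]‖ ≤ (2dL + L)²·m`. [cite: Balaban1985Averaging, (14) p.19, (47) p.25] -/
theorem norm_comm_Tside_Tside_le (L : ℕ) (hL : 1 ≤ L) (hM : 0 ≤ M) (q : Site d) (κ : Fin d) (q' : Site d) (κ' : Fin d) :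
    ‖Tside L B q κ * Tside L B q' κ' - Tside L B q' κ' * Tside L B q κ‖ ≤ (2 * d * L + L) ^ 2 * M := by
  unfold Tside
  rw [comm_sum_smul_const_eq]
  refine norm_avg_le L hL _ fun r => ?_
  rw [← norm_neg, neg_sub, comm_sum_smul_const_eq]
  refine norm_avg_le L hL _ fun r' => ?_
  have hlen := mul_le_mul (length_gammaWord_le (d := d) L κ' r') (length_gammaWord_le (d := d) L κ r) (Nat.cast_nonneg _)
    (by positivity)
  calc _ ≤ ((gammaWord L κ' (boxVec L r')).length : ℝ) * (gammaWord L κ (boxVec L r)).length * M :=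
        norm_comm_asum_asum_le hB _ _ _ _
    _ ≤ (2 * d * L + L) * (2 * d * L + L) * M := mul_le_mul_of_nonneg_right hlen hM
    _ = (2 * d * L + L) ^ 2 * M := by ring

omit hB [CompleteSpace 𝔸] in
/-- **EVERY LINEAR ITERATE**: `‖[A_j(b), A_j(b′)]‖ ≤ ((2d+3)L)^{2j}·m` for `A_j = (rescale ∘ T)^{j}(A)` — each `T` costs at most
`(2dL + L)² ≤ ((2d+3)L)²`. [cite: Balaban1985Averaging, (14) p.19, (43) p.24] -/
theorem norm_comm_linIterate_le (L : ℕ) (hL : 1 ≤ L) {A : Site d → Fin d → 𝔸}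
    (hA : ∀ (x : Site d) (κ : Fin d) (y : Site d) (μ : Fin d), ‖A x κ * A y μ - A y μ * A x κ‖ ≤ M) (hM : 0 ≤ M) :
    ∀ (j : ℕ) (x : Site d) (κ : Fin d) (y : Site d) (μ : Fin d),
      ‖((fun B => rescale L (Tside L B))^[j] A) x κ * ((fun B => rescale L (Tside L B))^[j] A) y μ
        - ((fun B => rescale L (Tside L B))^[j] A) y μ * ((fun B => rescale L (Tside L B))^[j] A) x κ‖
        ≤ ((2 * d + 3) * L) ^ (2 * j) * M
  | 0 => by simpa using hA
  | j + 1 => by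
    intro x κ y μ
    rw [Function.iterate_succ_apply']
    have hMj : 0 ≤ ((2 * d + 3) * L : ℝ) ^ (2 * j) * M := mul_nonneg (by positivity) hM
    have hsq : (2 * d * L + L : ℝ) ^ 2 ≤ ((2 * d + 3) * L) ^ 2 :=
      pow_le_pow_left₀ (by positivity) (by nlinarith [(Nat.cast_nonneg L : (0 : ℝ) ≤ L)]) 2
    calc _ ≤ (2 * d * L + L : ℝ) ^ 2 * (((2 * d + 3) * L) ^ (2 * j) * M) :=
          norm_comm_Tside_Tside_le (norm_comm_linIterate_le L hL hA hM j) L hL hMj _ _ _ _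
      _ ≤ ((2 * d + 3) * L : ℝ) ^ 2 * (((2 * d + 3) * L) ^ (2 * j) * M) := mul_le_mul_of_nonneg_right hsq hMj
      _ = ((2 * d + 3) * L) ^ (2 * (j + 1)) * M := by ring

end CommBound

/-! ## §2 Curvature sizes along a curve with local data; every level of (43) -/

section CurveBound

variable {d : ℕ} {V : ℂ → Site d → Fin d → 𝔸ˣ} {A : Site d → Fin d → 𝔸} {K M : ℝ} (h0 : V 0 = 1)
  (hV : ∀ (y : Site d) (μ : Fin d), ∃ v₁ : ℂ → 𝔸, ∃ w : 𝔸,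
    (∀ᶠ t in 𝓝 (0 : ℂ), HasDerivAt (fun u : ℂ => ((V u y μ : 𝔸ˣ) : 𝔸)) (v₁ t) t) ∧ HasDerivAt v₁ w 0 ∧ v₁ 0 = A y μ)
  (hK : ∀ (y : Site d) (μ : Fin d), ‖iteratedDeriv 2 (fun t : ℂ => mlog ((V t y μ : 𝔸ˣ) : 𝔸)) 0‖ ≤ K)
  (hA : ∀ (x : Site d) (κ : Fin d) (y : Site d) (μ : Fin d), ‖A x κ * A y μ - A y μ * A x κ‖ ≤ M) (hM : 0 ≤ M)

include h0 hV hK in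
/-- Letter curvatures `≤ K` (`κ(−b) = −κ(b)`). [cite: Balaban1985Averaging, (9) p.18] -/
theorem norm_iteratedDeriv_two_mlog_stepHol_le (x : Site d) (l : Letter d) :
    ‖iteratedDeriv 2 (fun t : ℂ => mlog ((stepHol (V t) x l : 𝔸ˣ) : 𝔸)) 0‖ ≤ K := by
  obtain ⟨μ, b⟩ := l
  cases b
  · obtain ⟨v₁, w, hv, hv₁, -⟩ := hV (x - e μ) μ
    rw [iteratedDeriv_two_mlog_stepHol_false_loc h0 x μ hv hv₁, norm_neg]; exact hK _ _
  · rw [iteratedDeriv_two_mlog_stepHol_true]; exact hK _ _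

include h0 hV hK hA hM

/-- **WORD curvatures**: `‖κ(Γ)‖ ≤ |Γ|·K + |Γ|²·m` (each letter `≤ K`, each ordered pair of letters `≤ m`).
[cite: Balaban1985Averaging, (9) p.18, (21) p.21] -/
theorem norm_iteratedDeriv_two_mlog_hol_curve_le :
    ∀ (w : List (Letter d)) (x : Site d),
      ‖iteratedDeriv 2 (fun t : ℂ => mlog ((hol (V t) x w : 𝔸ˣ) : 𝔸)) 0‖ ≤ w.length * K + w.length ^ 2 * M
  | [], x => by rw [iteratedDeriv_two_mlog_hol_curve_nil]; simp
  | l :: w, x => by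
    rw [iteratedDeriv_two_mlog_hol_curve_cons_loc h0 hV, List.length_cons]
    have h1 := norm_iteratedDeriv_two_mlog_stepHol_le h0 hV hK x l
    have h2 := norm_iteratedDeriv_two_mlog_hol_curve_le w (x + l.vec)
    have h3 := norm_comm_stepA_asum_le hA x l w (x + l.vec)
    have hw : (0 : ℝ) ≤ w.length := Nat.cast_nonneg _
    calc _ ≤ ‖iteratedDeriv 2 (fun t : ℂ => mlog ((stepHol (V t) x l : 𝔸ˣ) : 𝔸)) 0‖
          + ‖iteratedDeriv 2 (fun t : ℂ => mlog ((hol (V t) (x + l.vec) w : 𝔸ˣ) : 𝔸)) 0‖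
          + ‖stepA A x l * asum A (x + l.vec) w - asum A (x + l.vec) w * stepA A x l‖ := norm_add₃_le
      _ ≤ K + (w.length * K + w.length ^ 2 * M) + w.length * M := add_le_add (add_le_add h1 h2) h3
      _ ≤ ((w.length + 1 : ℕ) : ℝ) * K + ((w.length + 1 : ℕ) : ℝ) ^ 2 * M := by
          push_cast
          nlinarith [mul_nonneg hw hM]

/-- **AVERAGED-BOND curvatures**: `‖d²/dt²|₀ log Ū_c(V(t))‖ ≤ (2d+3)L·K + ((2d+3)L)²·m` (file 10's one-step formula: the
`L^{−d}`-average of loop-word curvatures, `|Γ_{c,x} ∪ (−Γ_c)| ≤ 2dL + 2L`, plus `κ(Γ_c)`, `|Γ_c| = L`, plus `[X̂_c(A), A(Γ_c)]`).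
[cite: Balaban1985Averaging, (42) p.23, (15) p.19] -/
theorem norm_iteratedDeriv_two_mlog_bavg_curve_le (L : ℕ) (hL : 1 ≤ L) (hKnn : 0 ≤ K) (q : Site d) (κ : Fin d) :
    ‖iteratedDeriv 2 (fun t : ℂ => mlog ((bavg L (V t) q κ : 𝔸ˣ) : 𝔸)) 0‖
      ≤ (2 * d + 3) * L * K + ((2 * d + 3) * L) ^ 2 * M := by
  rw [iteratedDeriv_two_mlog_bavg_curve_loc h0 hV L q κ]
  have hsegL : ((seg κ (L : ℤ) : List (Letter d)).length : ℝ) = L := by rw [length_seg, Int.natAbs_natCast]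
  have hsum : ‖∑ r : Fin d → Fin L, (((L : ℝ) ^ d)⁻¹) • iteratedDeriv 2 (fun t : ℂ =>
        mlog ((hol (V t) q (gammaWord L κ (boxVec L r) ++ seg κ (-(L : ℤ))) : 𝔸ˣ) : 𝔸)) 0‖
      ≤ (2 * d * L + 2 * L) * K + (2 * d * L + 2 * L) ^ 2 * M := by
    refine norm_avg_le L hL _ fun r => ?_
    have h := norm_iteratedDeriv_two_mlog_hol_curve_le h0 hV hK hA hM (gammaWord L κ (boxVec L r) ++ seg κ (-(L : ℤ))) q
    have hlen := length_gammaWord_loop_le (d := d) L κ r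
    exact h.trans (add_le_add (mul_le_mul_of_nonneg_right hlen hKnn)
      (mul_le_mul_of_nonneg_right (pow_le_pow_left₀ (Nat.cast_nonneg _) hlen 2) hM))
  have hseg : ‖iteratedDeriv 2 (fun t : ℂ => mlog ((hol (V t) q (seg κ L) : 𝔸ˣ) : 𝔸)) 0‖ ≤ L * K + L ^ 2 * M := by
    have h := norm_iteratedDeriv_two_mlog_hol_curve_le h0 hV hK hA hM (seg κ L) q
    rwa [hsegL] at h
  have hcomm : ‖Xhat L A q κ * asum A q (seg κ L) - asum A q (seg κ L) * Xhat L A q κ‖ ≤ (2 * d * L + 2 * L) * L * M := by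
    have h := norm_comm_Xhat_asum_le hA L hL hM q κ q (seg κ L)
    rwa [hsegL] at h
  have hx : (0 : ℝ) ≤ (2 * d * L + 2 * L) * L * M := mul_nonneg (by positivity) hM
  calc _ ≤ _ := norm_add₃_le
    _ ≤ ((2 * d * L + 2 * L) * K + (2 * d * L + 2 * L) ^ 2 * M) + (L * K + L ^ 2 * M) + (2 * d * L + 2 * L) * L * M :=
        add_le_add (add_le_add hsum hseg) hcomm
    _ ≤ (2 * d + 3) * L * K + ((2 * d + 3) * L) ^ 2 * M := by nlinarith [hx]

/-- **EVERY LEVEL OF (43)**: for `L ≥ 1`, bond curvatures `≤ K` and commutators of the velocity field `≤ m` give, at level `j`,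
`‖d²/dt²|₀ log Ū^{j}(V(t))(b)‖ ≤ a^{j}·K + j·a^{2j}·m` with `a = (2d+3)L` (induction: `K_{j+1} ≤ aK_j + a²m_j`, `m_{j+1} ≤
a²m_j` by §1). [cite: Balaban1985Averaging, (43) p.24] -/
theorem norm_iteratedDeriv_two_mlog_avgIter_le (L : ℕ) (hL : 1 ≤ L) (hKnn : 0 ≤ K) :
    ∀ (j : ℕ) (z : Site d) (κ : Fin d),
      ‖iteratedDeriv 2 (fun t : ℂ => mlog ((avgIter L (V t) j z κ : 𝔸ˣ) : 𝔸)) 0‖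
        ≤ ((2 * d + 3) * L) ^ j * K + j * ((2 * d + 3) * L) ^ (2 * j) * M
  | 0 => by intro z κ; simpa using hK z κ
  | j + 1 => by
    intro z κ
    have ha1 : (1 : ℝ) ≤ (2 * d + 3) * L := by
      have hL1 : (1 : ℝ) ≤ L := by exact_mod_cast hL
      nlinarith [(Nat.cast_nonneg d : (0 : ℝ) ≤ d)]
    have hKj : (0 : ℝ) ≤ ((2 * d + 3) * L) ^ j * K + j * ((2 * d + 3) * L) ^ (2 * j) * M :=
      add_nonneg (mul_nonneg (by positivity) hKnn) (mul_nonneg (by positivity) hM)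
    have hMj : (0 : ℝ) ≤ ((2 * d + 3) * L) ^ (2 * j) * M := mul_nonneg (by positivity) hM
    have e : (fun t : ℂ => mlog ((avgIter L (V t) (j + 1) z κ : 𝔸ˣ) : 𝔸))
        = fun t : ℂ => mlog ((bavg L (avgIter L (V t) j) ((L : ℤ) • z) κ : 𝔸ˣ) : 𝔸) := rfl
    rw [e]
    have h := norm_iteratedDeriv_two_mlog_bavg_curve_le (V := fun t : ℂ => avgIter L (V t) j)
      (avgIter_curve_zero' L h0 j) (exists_derivData_avgIter L hL h0 hV j)
      (norm_iteratedDeriv_two_mlog_avgIter_le L hL hKnn j) (norm_comm_linIterate_le L hL hA hM j) hMj L hL hKj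
      ((L : ℤ) • z) κ
    have hstep : (j : ℝ) * ((2 * d + 3) * L) ^ (2 * j + 1) * M ≤ j * ((2 * d + 3) * L) ^ (2 * j + 2) * M :=
      mul_le_mul_of_nonneg_right (mul_le_mul_of_nonneg_left (pow_le_pow_right₀ ha1 (by omega)) (Nat.cast_nonneg _)) hM
    calc _ ≤ _ := h
      _ = ((2 * d + 3) * L) ^ (j + 1) * K
            + (j * ((2 * d + 3) * L) ^ (2 * j + 1) * M + ((2 * d + 3) * L) ^ (2 * j + 2) * M) := by ring
      _ ≤ ((2 * d + 3) * L) ^ (j + 1) * K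
            + (j * ((2 * d + 3) * L) ^ (2 * j + 2) * M + ((2 * d + 3) * L) ^ (2 * j + 2) * M) :=
          by linarith [hstep]
      _ = ((2 * d + 3) * L) ^ (j + 1) * K + ((j + 1 : ℕ) : ℝ) * ((2 * d + 3) * L) ^ (2 * (j + 1)) * M := by
          push_cast; ring

end CurveBound

/-! ## §3 The ray `U = e^{tA}`: the diagonal curvature of every level of (43) is controlled by the non-commutativity of `A` -/

section RayBound

variable {d : ℕ} {A : Site d → Fin d → 𝔸} {M : ℝ}
  (hA : ∀ (x : Site d) (κ : Fin d) (y : Site d) (μ : Fin d), ‖A x κ * A y μ - A y μ * A x κ‖ ≤ M) (hM : 0 ≤ M)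

include hA hM

/-- **LEVEL 1 — the one-step average (42)∕(15) along `e^{tA}`**: for every `L ≥ 1` and every `L`-bond `c = ⟨q, q + Le_κ⟩`,
`‖d²/dt²|₀ log Ū_c(e^{tA})‖ ≤ ((2d+3)L)²·m`, `m` = the largest pairwise commutator of the values of `A` (gen 9's door (d)
formula, file 8, made a number). [cite: Balaban1985Averaging, (15) p.19, p.20, (42) p.23] -/
theorem norm_iteratedDeriv_two_mlog_bavg_expCfg_le (L : ℕ) (hL : 1 ≤ L) (q : Site d) (κ : Fin d) :
    ‖iteratedDeriv 2 (fun t : ℂ => mlog ((bavg L (expCfg (t • A)) q κ : 𝔸ˣ) : 𝔸)) 0‖ ≤ ((2 * d + 3) * L) ^ 2 * M := by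
  have h := norm_iteratedDeriv_two_mlog_bavg_curve_le (V := fun t : ℂ => expCfg (t • A)) (K := 0)
    (by simp only [zero_smul, expCfg_zero]) (exists_derivData_expCfg_smul A)
    (fun y μ => by rw [iteratedDeriv_two_mlog_expCfg_smul, norm_zero]) hA hM L hL le_rfl q κ
  simpa using h

/-- **EVERY LEVEL — `‖d²/dt²|₀ log Ū^{j}(e^{tA})(b)‖ ≤ j·((2d+3)L)^{2j}·m`**: the diagonal curvature of Bałaban's ITERATED
averaging (43) with its contour system, along the ray `e^{tA}` of ANY bond field, at every level and every bond, is bounded by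
the non-commutativity of the field alone — zero in every abelian sector (gen 8 ∕ file 11), small for nearly commuting fields.
[cite: Balaban1985Averaging, (15) p.19, (43) p.24] -/
theorem norm_iteratedDeriv_two_mlog_avgIter_expCfg_le (L : ℕ) (hL : 1 ≤ L) (j : ℕ) (z : Site d) (κ : Fin d) :
    ‖iteratedDeriv 2 (fun t : ℂ => mlog ((avgIter L (expCfg (t • A)) j z κ : 𝔸ˣ) : 𝔸)) 0‖
      ≤ j * ((2 * d + 3) * L) ^ (2 * j) * M := by
  have h := norm_iteratedDeriv_two_mlog_avgIter_le (V := fun t : ℂ => expCfg (t • A)) (K := 0)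
    (by simp only [zero_smul, expCfg_zero]) (exists_derivData_expCfg_smul A)
    (fun y μ => by rw [iteratedDeriv_two_mlog_expCfg_smul, norm_zero]) hA hM L hL le_rfl j z κ
  simpa using h

end RayBound

end Summit.QuantumFields.BalabanUV.T4Continuum.NE1p.B7AveragingCommutator

end
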